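import Mathlib
import Literature.AlgebraicGeometry.Resolution.KummerNormalForm
import Literature.AlgebraicGeometry.Resolution.GiraudNormalFormTransport
import Literature.AlgebraicGeometry.Resolution.SNCParameters
import Literature.AlgebraicGeometry.Resolution.DivisorialMonoid
import Literature.AlgebraicGeometry.Resolution.PCyclicCoverNormalizationSections

/-!
# Crux `PicoverLocalModel` (stmt-ResolutionOfSingularities-0557), line `SketchIdeator3`
# (giraud-cossart-normal-form) — endgame, local charts: the data at the points of the chart

Helper of the stub `stub_localCharts`. On an affine open `U` of the base `W` carrying spread
boundary equations `xs_j ∈ Γ(W, U)` — the ideal of the boundary component `D_j` (through the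
centre) on `U` is `(xs_j)`, the other members of `E` have the unit ideal on `U` — this file
reads off, at an arbitrary point `w' ∈ U` with prime `𝔮'`:

* `mem_support_iff_of_spread` — the components of `E` through `w'` are the `D_j` with
  `xs_j ∈ 𝔮'`;
* `hli_of_spread` — the germs of those `xs_j` are independent modulo `𝔪²` (`HasSNC`);
* `giraudNormalFormAt_of_spread` — the Giraud normal form supplied at `w'` by
  `InGiraudNormalForm` (with its own enumeration and generators) is one for the germs of the
  `xs_j`, `xs_j ∈ 𝔮'`, in ANY injective enumeration (`GiraudNormalFormAt.reindex`);
* `divisorialMonoid_prod_stalkIdeal_eq` — the prescribed stalk monoid of the stub (divisorial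
  monoid of the product over `E` of the stalk ideals) is the divisorial monoid of `∏ xs_j`.
-/

noncomputable section

-- single-problem summit: the doubled namespace component `ResolutionOfSingularities` is the tree layout
set_option linter.dupNamespace false

open CategoryTheory AlgebraicGeometry TopologicalSpace IsLocalRing
open Literature.AlgebraicGeometry.Resolution

namespace Summit.ResolutionOfSingularities.ResolutionOfSingularities.Theorems.PicoverLocalModel.LocalCharts

section Spread

variable {W : Scheme.{0}} {E : List W.IdealSheafData} {U : W.affineOpens} {r : ℕ}
  {D : Fin r → W.IdealSheafData} (hDE : ∀ j, D j ∈ E) (hDinj : Function.Injective D)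
  {xs : Fin r → Γ(W, (U : W.Opens))} (hB1 : ∀ j, (D j).ideal U = Ideal.span {xs j})
  (hB2 : ∀ D' ∈ E, (∀ j, D j ≠ D') → D'.ideal U = ⊤) {w' : W} (hw' : w' ∈ (U : W.Opens))

include hB1 in
/-- The stalk ideal of `D_j` at a point of `U` is generated by the germ of `xs_j`. [folklore] -/
theorem stalkIdeal_eq_span_germ_of_spread (j : Fin r) :
    stalkIdeal (D j) w' = Ideal.span {W.presheaf.germ (U : W.Opens) w' hw' (xs j)} := by
  rw [stalkIdeal_eq_map_germ (D j) U hw', hB1, Ideal.map_span, Set.image_singleton]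

include hB2 hw' in
/-- The stalk ideal of a member of `E` other than the `D_j` at a point of `U` is the unit ideal.
[folklore] -/
theorem stalkIdeal_eq_top_of_spread {D' : W.IdealSheafData} (hD' : D' ∈ E) (hne : ∀ j, D j ≠ D') :
    stalkIdeal D' w' = ⊤ := by
  rw [stalkIdeal_eq_map_germ D' U hw', hB2 D' hD' hne, Ideal.map_top]

include hB1 in
/-- `w'` lies on `D_j` iff the germ of `xs_j` is not a unit. [folklore] -/
theorem mem_support_iff_of_spread' (j : Fin r) :
    w' ∈ (D j).support ↔ ¬ IsUnit (W.presheaf.germ (U : W.Opens) w' hw' (xs j)) := by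
  rw [mem_support_iff_stalkIdeal_le, stalkIdeal_eq_span_germ_of_spread hB1 hw',
    Ideal.span_singleton_le_iff_mem, IsLocalRing.mem_maximalIdeal, mem_nonunits_iff]

include hB1 hB2 in
/-- **The members of `E` through `w'` are the `D_j` whose equation is not a unit at `w'`.**
[folklore] -/
theorem mem_support_iff_of_spread {D' : W.IdealSheafData} (hD' : D' ∈ E) :
    w' ∈ D'.support ↔ ∃ j, D j = D' ∧ ¬ IsUnit (W.presheaf.germ (U : W.Opens) w' hw' (xs j)) := by
  constructor
  · intro h
    by_cases hj : ∃ j, D j = D'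
    · obtain ⟨j, rfl⟩ := hj
      exact ⟨j, rfl, (mem_support_iff_of_spread' hB1 hw' j).mp h⟩
    · push Not at hj
      rw [mem_support_iff_stalkIdeal_le, stalkIdeal_eq_top_of_spread hB2 hw' hD' hj, top_le_iff] at h
      exact absurd h (maximalIdeal.isMaximal _).ne_top
  · rintro ⟨j, rfl, h⟩
    exact (mem_support_iff_of_spread' hB1 hw' j).mpr h

include hDE hDinj hB1 in
/-- **Independence modulo `𝔪²` at `w'`** of the germs of the `xs_{σ i}` through `w'`, from
`HasSNC E`. [cite: BierstoneGrigorievMilmanWlodarczyk2011, Def. 3.1.1] -/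
theorem hli_of_spread (hE : HasSNC E) {s : ℕ} (σ : Fin s → Fin r) (hσ : Function.Injective σ)
    (hmem : ∀ i, ¬ IsUnit (W.presheaf.germ (U : W.Opens) w' hw' (xs (σ i)))) :
    (∀ i, W.presheaf.germ (U : W.Opens) w' hw' (xs (σ i)) ∈ maximalIdeal (W.presheaf.stalk w')) ∧
    ∀ α : Fin s → W.presheaf.stalk w',
      ∑ i, α i * W.presheaf.germ (U : W.Opens) w' hw' (xs (σ i)) ∈ maximalIdeal (W.presheaf.stalk w') ^ 2 →
      ∀ i, α i ∈ maximalIdeal (W.presheaf.stalk w') := by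
  refine hli_of_hasSNC hE w'
    (D := fun i => ⟨D (σ i), hDE _, (mem_support_iff_of_spread' hB1 hw' _).mpr (hmem i)⟩)
    (fun i i' h => hσ (hDinj (congrArg Subtype.val h))) _ fun i => ?_
  exact stalkIdeal_eq_span_germ_of_spread hB1 hw' (σ i)

include hDE hDinj hB1 hB2 in
/-- **The Giraud normal form at `w'` for the spread equations.** If `π^* a` is in Giraud
normal form along `E` at `w'` (for SOME enumeration of the components through `w'` and SOME
generators of their stalk ideals), then it is in Giraud normal form for the germs of the
`xs_j` not invertible at `w'`, in any injective enumeration `σ` of them.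
[cite: Giraud1983, Prop. 1.5] -/
theorem giraudNormalFormAt_of_spread [IsIntegral W] {R : Type} [CommRing R] {p : ℕ}
    (π : W ⟶ Spec (.of R)) (a : R) (hG : InGiraudNormalForm p W π a E)
    {s : ℕ} (σ : Fin s → Fin r) (hσ : Function.Injective σ)
    (hJ : ∀ j, ¬ IsUnit (W.presheaf.germ (U : W.Opens) w' hw' (xs j)) ↔ ∃ i, σ i = j) :
    GiraudNormalFormAt p (fun i => W.presheaf.germ (U : W.Opens) w' hw' (xs (σ i)))
      (W.presheaf.germ (U : W.Opens) w' hw' (π.appLE ⊤ U le_top ((Scheme.ΓSpecIso (.of R)).inv a))) := by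
  classical
  obtain ⟨r', D', x', hbij, hgen, hNF⟩ := hG w'
  -- match the two enumerations of the components through `w'`
  have key : ∀ i', ∃ i, D (σ i) = (D' i').1 := fun i' => by
    obtain ⟨j, hj, hju⟩ := (mem_support_iff_of_spread hB1 hB2 hw' (D' i').2.1).mp (D' i').2.2
    obtain ⟨i, rfl⟩ := (hJ j).mp hju
    exact ⟨i, hj⟩
  choose τ hτ using key
  have hτinj : Function.Injective τ := fun i₁ i₂ h => by
    have : (D' i₁).1 = (D' i₂).1 := by rw [← hτ i₁, ← hτ i₂, h]
    exact hbij.1 (Subtype.ext this)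
  have hτsurj : Function.Surjective τ := fun i => by
    have hsupp : w' ∈ (D (σ i)).support :=
      (mem_support_iff_of_spread' hB1 hw' _).mpr ((hJ _).mpr ⟨i, rfl⟩)
    obtain ⟨i', hi'⟩ := hbij.2 ⟨D (σ i), hDE _, hsupp⟩
    refine ⟨i', hσ (hDinj ?_)⟩
    rw [hτ i', hi']
  let πe : Fin r' ≃ Fin s := Equiv.ofBijective τ ⟨hτinj, hτsurj⟩
  -- the two generators of each stalk ideal differ by a unit
  have hassoc : ∀ i', ∃ ε : W.presheaf.stalk w', IsUnit ε ∧
      x' i' = ε * W.presheaf.germ (U : W.Opens) w' hw' (xs (σ (πe i'))) := by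
    intro i'
    have h1 : Ideal.span {x' i'} = Ideal.span {W.presheaf.germ (U : W.Opens) w' hw' (xs (σ (τ i')))} := by
      rw [← hgen i', ← stalkIdeal_eq_span_germ_of_spread hB1 hw' (σ (τ i')), hτ i']
    obtain ⟨u, hu⟩ := Ideal.span_singleton_eq_span_singleton.mp h1
    refine ⟨↑u⁻¹, Units.isUnit _, ?_⟩
    change x' i' = ↑u⁻¹ * W.presheaf.germ (U : W.Opens) w' hw' (xs (σ (τ i')))
    rw [← hu, mul_comm (x' i') ↑u, ← mul_assoc, Units.inv_mul, one_mul]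
  choose ε hε hxε using hassoc
  have hNF' := hNF.reindex (y := fun k => W.presheaf.germ (U : W.Opens) w' hw' (xs (σ k))) πe ε hε hxε
  have hrad : W.presheaf.germ (U : W.Opens) w' hw' (π.appLE ⊤ U le_top ((Scheme.ΓSpecIso (.of R)).inv a)) =
      W.presheaf.germ ⊤ w' trivial (π.appTop ((Scheme.ΓSpecIso (.of R)).inv a)) := by
    rw [Scheme.Hom.appLE, CommRingCat.comp_apply]
    exact TopCat.Presheaf.germ_res_apply W.presheaf (homOfLE le_top) w' hw' _
  rw [hrad]
  exact hNF'

include hDE hB1 hB2 in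
/-- **The prescribed stalk monoid is the divisorial monoid of `∏ xs_j`.** For any ring map
`σ : 𝒪_{W,w'} → N` (the stalk map of the normalised cover at a point over `w'`), the
divisorial monoid of the extension of `∏_{D ∈ E} (stalk ideal of D at w')` is the divisorial
monoid of `σ(∏_j xs_j)`: both conditions on a prime `𝔭` of `N` say that `𝔭` contains the
image of some `xs_j`. [cite: Kato1994, Thm. 11.6] -/
theorem divisorialMonoid_prod_stalkIdeal_eq {N : Type*} [CommRing N] (σN : W.presheaf.stalk w' →+* N) :
    divisorialMonoid (((E.map fun D' => stalkIdeal D' w').prod).map σN) =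
      divisorialMonoid (Ideal.span {σN (W.presheaf.germ (U : W.Opens) w' hw' (∏ j, xs j))}) := by
  classical
  have hmap : ((E.map fun D' => stalkIdeal D' w').prod).map σN =
      (E.map fun D' => (stalkIdeal D' w').map σN).prod := by
    have := map_list_prod (Ideal.mapHom σN) (E.map fun D' => stalkIdeal D' w')
    rw [List.map_map] at this
    exact this
  ext z
  rw [mem_divisorialMonoid_iff_forall_isPrime, mem_divisorialMonoid_iff_forall_isPrime]
  refine forall_congr' fun 𝔭 => forall_congr' fun h𝔭 => forall_congr' fun hz => ?_
  haveI := h𝔭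
  rw [Ideal.span_singleton_le_iff_mem, map_prod, map_prod, Ideal.IsPrime.prod_mem_iff, hmap,
    ← Multiset.prod_coe, h𝔭.multiset_prod_le]
  simp only [Multiset.mem_coe, List.mem_map]
  constructor
  · rintro ⟨_, ⟨D', hD', rfl⟩, hle⟩
    by_cases hj : ∃ j, D j = D'
    · obtain ⟨j, rfl⟩ := hj
      refine ⟨j, Finset.mem_univ _, ?_⟩
      rw [stalkIdeal_eq_span_germ_of_spread hB1 hw', Ideal.map_span, Set.image_singleton,
        Ideal.span_singleton_le_iff_mem] at hle
      exact hle
    · push Not at hj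
      rw [stalkIdeal_eq_top_of_spread hB2 hw' hD' hj, Ideal.map_top, top_le_iff] at hle
      exact absurd hle h𝔭.ne_top
  · rintro ⟨j, -, hj⟩
    refine ⟨_, ⟨D j, hDE j, rfl⟩, ?_⟩
    rw [stalkIdeal_eq_span_germ_of_spread hB1 hw', Ideal.map_span, Set.image_singleton,
      Ideal.span_singleton_le_iff_mem]
    exact hj

end Spread

/-! ## Registered forms -/

/-- **The Giraud normal form at a point of the chart, for the spread equations** (registered
form of `giraudNormalFormAt_of_spread`). [cite: Giraud1983, Prop. 1.5] -/
theorem pointData_giraudNormalFormAt : ∀ {W : Scheme.{0}} [IsIntegral W] {E : List W.IdealSheafData} {U : W.affineOpens} {r : ℕ} {D : Fin r → W.IdealSheafData}, (∀ j, D j ∈ E) → Function.Injective D → ∀ {xs : Fin r → Γ(W, (U : W.Opens))}, (∀ j, (D j).ideal U = Ideal.span {xs j}) → (∀ D' ∈ E, (∀ j, D j ≠ D') → D'.ideal U = ⊤) → ∀ {w' : W} (hw' : w' ∈ (U : W.Opens)) {R : Type} [CommRing R] {p : ℕ} (π : W ⟶ Spec (.of R)) (a : R), InGiraudNormalForm p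 W π a E → ∀ {s : ℕ} (σ : Fin s → Fin r), Function.Injective σ → (∀ j, ¬ IsUnit (W.presheaf.germ (U : W.Opens) w' hw' (xs j)) ↔ ∃ i, σ i = j) → GiraudNormalFormAt p (fun i => W.presheaf.germ (U : W.Opens) w' hw' (xs (σ i))) (W.presheaf.germ (U : W.Opens) w' hw' (π.appLE ⊤ U le_top ((Scheme.ΓSpecIso (.of R)).inv a))) := by
  intro W _ E U r D hDE hDinj xs hB1 hB2 w' hw' R _ p π a hG s σ hσ hJ
  exact giraudNormalFormAt_of_spread hDE hDinj hB1 hB2 hw' π a hG σ hσ hJ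

/-- **The prescribed stalk monoid is the divisorial monoid of the boundary equation**
(registered form of `divisorialMonoid_prod_stalkIdeal_eq`). [cite: Kato1994, Thm. 11.6] -/
theorem pointData_divisorialMonoid : ∀ {W : Scheme.{0}} {E : List W.IdealSheafData} {U : W.affineOpens} {r : ℕ} {D : Fin r → W.IdealSheafData}, (∀ j, D j ∈ E) → ∀ {xs : Fin r → Γ(W, (U : W.Opens))}, (∀ j, (D j).ideal U = Ideal.span {xs j}) → (∀ D' ∈ E, (∀ j, D j ≠ D') → D'.ideal U = ⊤) → ∀ {w' : W} (hw' : w' ∈ (U : W.Opens)) {N : Type} [CommRing N] (σN : W.presheaf.stalk w' →+* N), divisorialMonoid (((E.map fun D' => stalkIdeal D' w').prod).map σN) = divisorialMonoid (Ideal.span {σN (W.presheaf.germ (U : W.Opens) w' hw' (∏ j, xs j))}) := by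
  intro W E U r D hDE xs hB1 hB2 w' hw' N _ σN
  exact divisorialMonoid_prod_stalkIdeal_eq hDE hB1 hB2 hw' σN

end Summit.ResolutionOfSingularities.ResolutionOfSingularities.Theorems.PicoverLocalModel.LocalCharts

end
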